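import Summits.KontsevichZagierPeriods.Zeta5Search.WedgeDictionaryOmegaRec
import Summits.KontsevichZagierPeriods.Zeta5Search.WedgeDictionarySlotSevenTwo
import Summits.KontsevichZagierPeriods.Zeta5Search.QWedgeClosedFormProof
import HarnessLib

/-!
# Wedge dictionary — CF-M3 proved: the gauge step and the induction along slot 7 (L9)

HONEST FRAMING: systematic search; no irrationality claim unless certified.

Provenance: written by planner gen-1 g5 (staged `HOME/lean/WedgeDictionaryGaugeStep.lean`, sha256 200d4abccdb5); filed verbatim
(four one-line docstrings added) by typer g6.

OUR work (Summit side; cell `pub-zeta5`, generation-1 seat g5, 2026-08-20).  This file closes the cell's Lean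
plan for `WedgeDictionary.casoratianClosedForm` (CF-M3, the closed form of the Casoratian `M₃ = U∧W` of the
weight-3 wedge dictionary on every admissible shape):

* `cf_step` — **gauge compatibility**: if the closed form holds at `a`, `a+e₇`, `a+2e₇` then it holds at
  `a+3e₇`.  The two order-3 recurrences along slot 7 — `quadM3_rec3` for `M₃` (L5, `WedgeDictionaryRec3`) and
  `OmegaRec.omegaVWP_rec3` for the terminating very-well-poised sum `Ω` (L8 = REC3′, `WedgeDictionaryOmegaRec`)
  — are the same recurrence in the gauge `M₃ = (−1)ⁿ·4·d!·F·Ω/(n!·P)`; the proof is slot-7 bookkeeping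
  (`pairProd_slot7_step`, `singles_slot7_step`, `dfact_slot7_step`, three times each), `topGamma0_eq`,
  `topGamma3_eq`, and ONE `linear_combination` in which the six-fold row products are kept atomic.
* `cf_induct` / `casoratianClosedForm_of_layerTwo` — strong induction on `b₇` from the layers `b₇ = 0`
  (`casoratianClosedForm_face`), `b₇ = 1` (`casoratianClosedForm_bseven_one`) and `b₇ = 2` (hypothesis
  `LayerTwo`, discharged by `casoratianClosedForm_bseven_two` of `WedgeDictionarySlotSevenTwo`).
* `casoratianClosedForm_holds : casoratianClosedForm` — **CF-M3**.
* `omegaVWP_rec3H` — `omegaVWP_rec3` in the exact hypothesis shape of `WedgeDictionaryInterior`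
  (`casoratianClosedForm_of_omegaRec3`, lead g4), so that route closes too.
* `qPart_holds` — the `Q`-part of `wedgeDictionary`, `Q(a) = ρ(a)·M₃(b(a))`, UNCONDITIONALLY on the whole region
  (CF-M3 + CF-Q via `qPart_of_casoratianClosedForm`).

Kernel status (gen-1 g5 scratch): this section rc 0 with `omegaVWP_rec3` stubbed (58 s) and rc 0 / 0 sorries as
part of the monolithic OmegaRec file; `#print axioms` standard.
-/

noncomputable section

open Finset Polynomial

namespace Summit.KontsevichZagierPeriods.Zeta5Search.WedgeDictionary.OmegaRec

open Summit.KontsevichZagierPeriods.Zeta5Search.DualSeries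

section Interior

/-- The closed-form statement for ONE shape: literally the conclusion of `casoratianClosedForm`. -/
def CF (b : ℕ → ℤ) : Prop :=
  quadM3 b * (((b 0).toNat.factorial : ℚ) *
      (allPairs.map fun jk => ((b 0 - b jk.1 - b jk.2).toNat.factorial : ℚ)).prod) =
    (-1 : ℚ) ^ (b 0).toNat * 4 * ((dOf b).toNat.factorial : ℚ) *
      (∏ j ∈ range 7, ((b 0 - b (j + 1)).toNat.factorial : ℚ)) * omegaVWP b

/-- `casoratianClosedForm` is literally `∀ b, (admissible b) → CF b`. -/
theorem casoratianClosedForm_iff : casoratianClosedForm ↔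
    ∀ b : ℕ → ℤ, InBox b → 0 ≤ dOf b → (∀ j ∈ Icc 1 7, b j ≤ b 0) →
      (∀ jk ∈ allPairs, b jk.1 + b jk.2 ≤ b 0) → CF b := Iff.rfl

/-- `e₁ = 3n − a₇ − d`. -/
theorem fe1_eq_dOf (a : ℕ → ℤ) : fe1 a = 3 * (a 0 : ℚ) - (a 7 : ℚ) - (dOf a : ℚ) := by
  have h := sum_slots_eq a
  simp [sum_range_succ] at h
  have h' : ((a 1 + a 2 + a 3 + a 4 + a 5 + a 6 : ℤ) : ℚ) = ((3 * a 0 - dOf a - a 7 : ℤ) : ℚ) := by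
    congr 1; omega
  push_cast at h'
  unfold fe1
  linarith

set_option maxHeartbeats 1600000 in
/-- **Gauge compatibility (the inductive step of CF-M3 along slot 7).** If the closed form holds at
`a`, `a+e₇`, `a+2e₇` then it holds at `a+3e₇` (`3 ≤ d(a)`, the pair bounds of `a+3e₇`):
`quadM3_rec3` (L5) and `omegaVWP_rec3` (L8) are the same recurrence in the gauge (4.4). -/
theorem cf_step (a : ℕ → ℤ) (ha : InBox a) (hd : 3 ≤ dOf a)
    (hp7 : ∀ i ∈ range 6, a (i + 1) + a 7 + 3 ≤ a 0)
    (hpr : ∀ i ∈ range 6, ∀ j ∈ range 6, i ≠ j → a (i + 1) + a (j + 1) ≤ a 0)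
    (IH0 : CF a) (IH1 : CF (bump a 6)) (IH2 : CF (bump (bump a 6) 6)) :
    CF (bump (bump (bump a 6) 6) 6) := by
  unfold CF at *
  have hi7 : (6 : ℕ) ∈ range 7 := mem_range.2 (by norm_num)
  have h05 : (0 : ℕ) ∈ range 6 := mem_range.2 (by norm_num)
  have h73 : a 7 + 3 ≤ a 0 := by have := hp7 0 h05; have := (ha.2 0 (mem_range.2 (by norm_num))).1; omega
  -- slot values of the three bumped shapes
  have h10 : bump a 6 0 = a 0 := bump_zero a 6
  have h17 : bump a 6 7 = a 7 + 1 := bump_self a 6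
  have h1r : ∀ i ∈ range 6, bump a 6 (i + 1) = a (i + 1) := fun i hi =>
    bump_of_ne a (by have := mem_range.1 hi; omega)
  have h20 : bump (bump a 6) 6 0 = a 0 := (bump_zero _ 6).trans h10
  have h27 : bump (bump a 6) 6 7 = a 7 + 2 := by rw [bump_self, h17]; ring
  have h2r : ∀ i ∈ range 6, bump (bump a 6) 6 (i + 1) = a (i + 1) := fun i hi => by
    rw [bump_of_ne _ (by have := mem_range.1 hi; omega), h1r i hi]
  have h30 : bump (bump (bump a 6) 6) 6 0 = a 0 := (bump_zero _ 6).trans h20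
  have h37 : bump (bump (bump a 6) 6) 6 7 = a 7 + 3 := by rw [bump_self, h27]; ring
  have h3r : ∀ i ∈ range 6, bump (bump (bump a 6) 6) 6 (i + 1) = a (i + 1) := fun i hi => by
    rw [bump_of_ne _ (by have := mem_range.1 hi; omega), h2r i hi]
  have hd1 : dOf (bump a 6) = dOf a - 1 := dOf_bump a hi7
  have hd2 : dOf (bump (bump a 6) 6) = dOf a - 2 := by rw [dOf_bump _ hi7, hd1]; ring
  have hd3 : dOf (bump (bump (bump a 6) 6) 6) = dOf a - 3 := by rw [dOf_bump _ hi7, hd2]; ring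
  -- the two recurrences
  have REC := quadM3_rec3 a ha hd h73
  have OREC := omegaVWP_rec3 a ha.1 (fun i hi => (ha.2 i (by have := mem_range.1 hi; exact mem_range.2 (by omega))).1)
    hp7 hpr
  -- slot-7 bookkeeping, three times each
  have hP0 := pairProd_slot7_step a (fun i hi => by have := hp7 i hi; omega)
  have hP1 := pairProd_slot7_step (bump a 6) (fun i hi => by rw [h1r i hi, h17, h10]; have := hp7 i hi; omega)
  have hP2 := pairProd_slot7_step (bump (bump a 6) 6)
    (fun i hi => by rw [h2r i hi, h27, h20]; have := hp7 i hi; omega)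
  have hF0 := singles_slot7_step a (by omega)
  have hF1 := singles_slot7_step (bump a 6) (by rw [h17, h10]; omega)
  have hF2 := singles_slot7_step (bump (bump a 6) 6) (by rw [h27, h20]; omega)
  have hD0 := dfact_slot7_step a (by omega)
  have hD1 := dfact_slot7_step (bump a 6) (by rw [hd1]; omega)
  have hD2 := dfact_slot7_step (bump (bump a 6) 6) (by rw [hd2]; omega)
  -- canonical six-fold products
  have cX0 : ∏ i ∈ range 6, ((a 0 : ℚ) - a (i + 1) - a 7) = ∏ i ∈ range 6, ((a 0 : ℚ) - a (i + 1) - a 7) := rfl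
  have cX1 : ∏ i ∈ range 6, ((bump a 6 0 : ℚ) - bump a 6 (i + 1) - bump a 6 7) =
      ∏ i ∈ range 6, ((a 0 : ℚ) - a (i + 1) - (a 7 + 1)) :=
    prod_congr rfl fun i hi => by rw [h10, h1r i hi, h17]; push_cast; ring
  have cX2 : ∏ i ∈ range 6, ((bump (bump a 6) 6 0 : ℚ) - bump (bump a 6) 6 (i + 1) - bump (bump a 6) 6 7) =
      ∏ i ∈ range 6, ((a 0 : ℚ) - a (i + 1) - (a 7 + 2)) :=
    prod_congr rfl fun i hi => by rw [h20, h2r i hi, h27]; push_cast; ring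
  have cG0 : ∏ k ∈ range 6, ((a 0 : ℚ) - a 7 - a (k + 1)) = ∏ i ∈ range 6, ((a 0 : ℚ) - a (i + 1) - a 7) :=
    prod_congr rfl fun i hi => by ring
  have cG1 : ∏ k ∈ range 6, ((bump a 6 0 : ℚ) - bump a 6 7 - bump a 6 (k + 1)) =
      ∏ i ∈ range 6, ((a 0 : ℚ) - a (i + 1) - (a 7 + 1)) :=
    prod_congr rfl fun i hi => by rw [h10, h1r i hi, h17]; push_cast; ring
  have cO2 : ∏ i ∈ range 6, ((a 0 : ℚ) - ((a 7 : ℚ) + 2) - a (i + 1)) =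
      ∏ i ∈ range 6, ((a 0 : ℚ) - a (i + 1) - (a 7 + 2)) :=
    prod_congr rfl fun i hi => by ring
  rw [cX1] at hP1
  rw [cX2] at hP2
  rw [cO2, fe1_eq_dOf] at OREC
  rw [topGamma3_eq, topGamma3_eq, topGamma0_eq, topGamma0_eq, cG0, cG1, hd1] at REC
  -- normalise slot-0 / slot-7 / dOf occurrences
  simp only [h10, h20, h30] at IH1 IH2 hP1 hP2 hF1 hF2 ⊢
  rw [h17] at hF1 REC
  rw [h27] at hF2
  rw [hd1] at hD0
  rw [hd1, hd2] at hD1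
  rw [hd2, hd3] at hD2
  rw [hd1] at IH1
  rw [hd2] at IH2
  rw [hd3]
  push_cast at hF1 hF2 hD1 hD2 REC IH1 IH2 ⊢
  -- telescope the bookkeeping into the top shape's factors
  rw [hP0, hP1, hP2, hF0, hF1, hF2, hD0, hD1, hD2] at IH0
  rw [hP1, hP2, hF1, hF2, hD1, hD2] at IH1
  rw [hP2, hF2, hD2] at IH2
  -- positivity of the multiplier
  have hdq : (3 : ℚ) ≤ (dOf a : ℚ) := by exact_mod_cast hd
  have hX : ∀ k : ℕ, k ≤ 2 → 0 < ∏ i ∈ range 6, ((a 0 : ℚ) - a (i + 1) - (a 7 + k)) := by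
    intro k hk
    refine prod_pos fun i hi => ?_
    have h := hp7 i hi
    have h' : ((a (i + 1) : ℤ) : ℚ) + (a 7 : ℚ) + 3 ≤ (a 0 : ℚ) := by exact_mod_cast h
    have hk' : (k : ℚ) ≤ 2 := by exact_mod_cast hk
    linarith
  have hX0 := hX 0 (by norm_num)
  have hX1 := hX 1 (by norm_num)
  have hX2 := hX 2 (by norm_num)
  simp only [Nat.cast_zero, add_zero, Nat.cast_one, Nat.cast_ofNat] at hX0 hX1 hX2
  have hK : (-((dOf a : ℚ) - 1 - 1)) * (-((dOf a : ℚ) - 1)) *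
      ((∏ i ∈ range 6, ((a 0 : ℚ) - a (i + 1) - a 7)) *
        (∏ i ∈ range 6, ((a 0 : ℚ) - a (i + 1) - (a 7 + 1))) *
        ∏ i ∈ range 6, ((a 0 : ℚ) - a (i + 1) - (a 7 + 2))) ≠ 0 := by
    have h1 : 0 < (dOf a : ℚ) - 1 - 1 := by linarith
    have h2 : 0 < (dOf a : ℚ) - 1 := by linarith
    exact mul_ne_zero (mul_ne_zero (neg_ne_zero.2 h1.ne') (neg_ne_zero.2 h2.ne'))
      (mul_ne_zero (mul_ne_zero hX0.ne' hX1.ne') hX2.ne')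
  refine mul_left_cancel₀ hK ?_
  linear_combination
    ((((a 0).toNat.factorial : ℕ) : ℚ) *
        (allPairs.map fun jk => ((a 0 - bump (bump (bump a 6) 6) 6 jk.1 -
            bump (bump (bump a 6) 6) 6 jk.2).toNat.factorial : ℚ)).prod *
        (∏ i ∈ range 6, ((a 0 : ℚ) - a (i + 1) - (a 7 + 2))) *
        (∏ i ∈ range 6, ((a 0 : ℚ) - a (i + 1) - (a 7 + 1))) *
        ∏ i ∈ range 6, ((a 0 : ℚ) - a (i + 1) - a 7)) * REC +
    (topGamma1 (bump a 6) * (-((dOf a : ℚ) - 1)) *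
        (∏ i ∈ range 6, ((a 0 : ℚ) - a (i + 1) - (a 7 + 1))) *
        ∏ i ∈ range 6, ((a 0 : ℚ) - a (i + 1) - a 7)) * IH2 -
    (((a 7 : ℚ) + 1 + 1) * (∏ i ∈ range 6, ((a 0 : ℚ) - a (i + 1) - (a 7 + 1))) * topGamma2 a *
        ∏ i ∈ range 6, ((a 0 : ℚ) - a (i + 1) - a 7)) * IH1 +
    (((a 7 : ℚ) + 1 + 1) * (∏ i ∈ range 6, ((a 0 : ℚ) - a (i + 1) - (a 7 + 1))) *
        (((a 7 : ℚ) + 1) * ∏ i ∈ range 6, ((a 0 : ℚ) - a (i + 1) - a 7))) * IH0 +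
    ((-1 : ℚ) ^ (a 0).toNat * 4 * (((dOf a - 3).toNat.factorial : ℕ) : ℚ) *
        (∏ j ∈ range 7, ((a 0 - bump (bump (bump a 6) 6) 6 (j + 1)).toNat.factorial : ℚ)) *
        ((dOf a : ℚ) - 1) * ((dOf a : ℚ) - 2) *
        (∏ i ∈ range 6, ((a 0 : ℚ) - a (i + 1) - (a 7 + 1))) *
        ∏ i ∈ range 6, ((a 0 : ℚ) - a (i + 1) - a 7)) * OREC

/-! ### Strong induction along slot 7 -/

/-- The `b₇ = 2` layer (I2; `casoratianClosedForm_bseven_two` of `WedgeDictionarySlotSevenTwo`). -/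
def LayerTwo : Prop :=
  ∀ b : ℕ → ℤ, InBox b → 0 ≤ dOf b → (∀ j ∈ Icc 1 7, b j ≤ b 0) →
    (∀ jk ∈ allPairs, b jk.1 + b jk.2 ≤ b 0) → b 7 = 2 → CF b

/-- Bumping slot 7 after setting it to `v` sets it to `v + 1`. -/
theorem bump_update7 (b : ℕ → ℤ) (v : ℤ) : bump (Function.update b 7 v) 6 = Function.update b 7 (v + 1) := by
  funext j
  by_cases hj : j = 7
  · subst hj; simp [bump]
  · simp [bump, hj]

/-- `d` after resetting slot 7. -/
theorem dOf_update7 (b : ℕ → ℤ) (v : ℤ) : dOf (Function.update b 7 v) = dOf b + b 7 - v := by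
  unfold dOf
  simp [sum_range_succ, Function.update_apply]
  ring

/-- Everything `cf_step` and the induction need about the lowered shape `a = b − (b₇−v)e₇` (`0 ≤ v ≤ b₇`). -/
theorem lowered_admissible (b : ℕ → ℤ) (hb : InBox b) (hd : 0 ≤ dOf b) (hle : ∀ j ∈ Icc 1 7, b j ≤ b 0)
    (hpairs : ∀ jk ∈ allPairs, b jk.1 + b jk.2 ≤ b 0) (v : ℤ) (hv0 : 0 ≤ v) (hv : v ≤ b 7) :
    InBox (Function.update b 7 v) ∧ 0 ≤ dOf (Function.update b 7 v) ∧
      (∀ j ∈ Icc 1 7, Function.update b 7 v j ≤ Function.update b 7 v 0) ∧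
      (∀ jk ∈ allPairs, Function.update b 7 v jk.1 + Function.update b 7 v jk.2 ≤ Function.update b 7 v 0) := by
  have h0 : Function.update b 7 v 0 = b 0 := Function.update_of_ne (by norm_num) _ _
  have hle' : ∀ j, Function.update b 7 v j ≤ b j := by
    intro j
    by_cases hj : j = 7
    · subst hj; simp [hv]
    · simp [hj]
  have h77 : b 7 ≤ b 0 := hle 7 (mem_Icc.2 ⟨by norm_num, le_rfl⟩)
  refine ⟨⟨by rw [h0]; exact hb.1, fun j hj => ?_⟩, ?_, fun j hj => ?_, fun jk hjk => ?_⟩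
  · by_cases hj7 : j + 1 = 7
    · rw [hj7, h0]; simp; omega
    · rw [Function.update_of_ne hj7, h0]; exact hb.2 j hj
  · rw [dOf_update7]; omega
  · rw [h0]; exact (hle' j).trans (hle j hj)
  · rw [h0]; exact (add_le_add (hle' _) (hle' _)).trans (hpairs jk hjk)

/-- Strong induction along slot 7 (bases: face `b₇ = 0`, `b₇ = 1`, the layer `b₇ = 2`; step `cf_step`). -/
theorem cf_induct (h2 : LayerTwo) (t : ℕ) : ∀ b : ℕ → ℤ, (b 7).toNat = t → InBox b → 0 ≤ dOf b →
    (∀ j ∈ Icc 1 7, b j ≤ b 0) → (∀ jk ∈ allPairs, b jk.1 + b jk.2 ≤ b 0) → CF b := by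
  induction t using Nat.strong_induction_on with
  | _ t ih =>
  intro b ht hb hd hle hpairs
  have h70 : 0 ≤ b 7 := (hb.2 6 (mem_range.2 (by norm_num))).1
  have h77 : b 7 ≤ b 0 := hle 7 (mem_Icc.2 ⟨by norm_num, le_rfl⟩)
  by_cases hz0 : b 7 = 0
  · unfold CF; exact casoratianClosedForm_face b hb hd hle hpairs hz0
  by_cases hz1 : b 7 = 1
  · unfold CF; exact casoratianClosedForm_bseven_one b hb hd hle hpairs hz1
  by_cases hz2 : b 7 = 2
  · exact h2 b hb hd hle hpairs hz2
  have h73 : 3 ≤ b 7 := by omega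
  -- lower slot 7 by three
  set a : ℕ → ℤ := Function.update b 7 (b 7 - 3) with hadef
  have e1 : bump a 6 = Function.update b 7 (b 7 - 2) := by rw [hadef, bump_update7]; congr 1; ring
  have e2 : bump (bump a 6) 6 = Function.update b 7 (b 7 - 1) := by rw [e1, bump_update7]; congr 1; ring
  have e3 : bump (bump (bump a 6) 6) 6 = b := by
    rw [e2, bump_update7, show b 7 - 1 + 1 = b 7 by ring, Function.update_eq_self]
  have ha0 : a 0 = b 0 := Function.update_of_ne (by norm_num) _ _
  have ha7 : a 7 = b 7 - 3 := Function.update_self _ _ _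
  have har : ∀ i ∈ range 6, a (i + 1) = b (i + 1) := fun i hi =>
    Function.update_of_ne (by have := mem_range.1 hi; omega) _ _
  obtain ⟨hA0, hdA0, hleA0, hpA0⟩ := lowered_admissible b hb hd hle hpairs (b 7 - 3) (by omega) (by omega)
  obtain ⟨hA1, hdA1, hleA1, hpA1⟩ := lowered_admissible b hb hd hle hpairs (b 7 - 2) (by omega) (by omega)
  obtain ⟨hA2, hdA2, hleA2, hpA2⟩ := lowered_admissible b hb hd hle hpairs (b 7 - 1) (by omega) (by omega)
  have hdA : 3 ≤ dOf a := by rw [hadef, dOf_update7]; omega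
  have hp7 : ∀ i ∈ range 6, a (i + 1) + a 7 + 3 ≤ a 0 := by
    intro i hi
    have hi6 := mem_range.1 hi
    rw [har i hi, ha7, ha0]
    have := pair_le_of_allPairs hpairs (j := i + 1) (k := 7) (by omega) (by omega) (by norm_num) le_rfl (by omega)
    omega
  have hpr : ∀ i ∈ range 6, ∀ j ∈ range 6, i ≠ j → a (i + 1) + a (j + 1) ≤ a 0 := by
    intro i hi j hj hij
    have hi6 := mem_range.1 hi
    have hj6 := mem_range.1 hj
    rw [har i hi, har j hj, ha0]
    exact pair_le_of_allPairs hpairs (j := i + 1) (k := j + 1) (by omega) (by omega) (by omega) (by omega)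
      (by omega)
  have IH0 : CF a := ih _ (by rw [← ht, ha7]; omega) a rfl hA0 hdA0 hleA0 hpA0
  have IH1 : CF (bump a 6) := by
    rw [e1]
    exact ih _ (by rw [← ht, Function.update_self]; omega) _ rfl hA1 hdA1 hleA1 hpA1
  have IH2 : CF (bump (bump a 6) 6) := by
    rw [e2]
    exact ih _ (by rw [← ht, Function.update_self]; omega) _ rfl hA2 hdA2 hleA2 hpA2
  have step := cf_step a hA0 hdA ?_ hpr IH0 IH1 IH2
  · rwa [e3] at step
  · exact hp7

/-- **CF-M3 from the `b₇ = 2` layer.** -/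
theorem casoratianClosedForm_of_layerTwo (h2 : LayerTwo) : casoratianClosedForm :=
  fun b hb hd hle hpairs => cf_induct h2 _ b rfl hb hd hle hpairs

/-- **CF-M3** (`casoratianClosedForm`) — from the face (`b₇ = 0`), the layers `b₇ = 1, 2` (`SlotSeven`,
`SlotSevenTwo`), the gauge step `cf_step` (`quadM3_rec3` + `omegaVWP_rec3`) and strong induction along slot 7. -/
theorem casoratianClosedForm_holds : casoratianClosedForm :=
  casoratianClosedForm_of_layerTwo fun b hb hd hle hpairs h7 => by
    unfold CF; exact casoratianClosedForm_bseven_two b hb hd hle hpairs h7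

/-- `omegaVWP_rec3` in the exact hypothesis shape `H` of lead g4's `WedgeDictionaryInterior`
(`casoratianClosedForm_of_omegaRec3`). -/
theorem omegaVWP_rec3H : ∀ a : ℕ → ℤ, InBox a → 3 ≤ dOf a → (∀ j ∈ Icc 1 7, a j ≤ a 0) →
    (∀ jk ∈ allPairs, a jk.1 + a jk.2 ≤ a 0) → (∀ i ∈ range 6, a (i + 1) + a 7 + 3 ≤ a 0) →
    -(∏ i ∈ range 6, ((a 0 : ℚ) - a (i + 1) - ((a 7 : ℚ) + 2))) * omegaVWP (bump (bump (bump a 6) 6) 6) -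
        ((a 0 : ℚ) - ((a 7 : ℚ) + 2)) * topGamma1 (bump a 6) * omegaVWP (bump (bump a 6) 6) -
        ((a 0 : ℚ) - ((a 7 : ℚ) + 2)) * ((a 7 : ℚ) + 2) * ((a 0 : ℚ) + 1 - ((a 7 : ℚ) + 2)) * topGamma2 a *
          omegaVWP (bump a 6) +
        ((a 0 : ℚ) - ((a 7 : ℚ) + 2)) * ((a 7 : ℚ) + 2) * ((a 7 : ℚ) + 1) * ((a 0 : ℚ) + 1 - ((a 7 : ℚ) + 2)) *
          ((a 0 : ℚ) + 2 - ((a 7 : ℚ) + 2)) * (dOf a : ℚ) * omegaVWP a = 0 := by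
  intro a ha hd hle hpairs hp7
  have hpr : ∀ i ∈ range 6, ∀ j ∈ range 6, i ≠ j → a (i + 1) + a (j + 1) ≤ a 0 := by
    intro i hi j hj hij
    have hi6 := mem_range.1 hi
    have hj6 := mem_range.1 hj
    exact pair_le_of_allPairs hpairs (j := i + 1) (k := j + 1) (by omega) (by omega) (by omega) (by omega)
      (by omega)
  have R := omegaVWP_rec3 a ha.1 (fun i hi => (ha.2 i (mem_range.2 (by have := mem_range.1 hi; omega))).1)
    hp7 hpr
  have cO2 : ∏ i ∈ range 6, ((a 0 : ℚ) - ((a 7 : ℚ) + 2) - a (i + 1)) =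
      ∏ i ∈ range 6, ((a 0 : ℚ) - a (i + 1) - ((a 7 : ℚ) + 2)) := prod_congr rfl fun i _ => by ring
  rw [cO2, fe1_eq_dOf] at R
  linear_combination R

open Literature.NumberTheory.Irrationality.BrownZudilin2022 (bOfA Converges QOf) in
/-- **The `Q`-part of the wedge dictionary is a theorem**: `Q(a) = ρ(a)·M₃(b(a))` on the whole region
(CF-M3 + typer g6's `qPart_of_casoratianClosedForm`, i.e. CF-Q). -/
theorem qPart_holds (a : Fin 8 → ℤ) (hconv : Converges a)
    (hreg : ∀ i ∈ Icc 1 7, 0 ≤ bOfA a i ∧ 2 * bOfA a i ≤ bOfA a 0 + 1) (hd : 0 ≤ dOf (bOfA a)) :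
    (QOf a : ℚ) = rhoOf a * quadM3 (bOfA a) :=
  qPart_of_casoratianClosedForm casoratianClosedForm_holds a hconv hreg hd

end Interior

end Summit.KontsevichZagierPeriods.Zeta5Search.WedgeDictionary.OmegaRec
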